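import Literature.InformationTheory.QuantumCodes.LinearProgrammingBoundAdditive
import HarnessLib

/-!
# The linear-programming bound with integrality («special upper bounds», CRSS 1998 §7) — the integer system and its proof

Topic `Literature/InformationTheory/QuantumCodes` (venture QEC, cell `qec`, row 06 / rung X1). Calderbank–Rains–Shor–Sloane
derive their «special upper bounds» (the entries of Table III marked `β`) by adding to the linear program of Thm. 21
«special knowledge about particular codes»: «Additional constraints can be included in Theorem 21 … Many variations are
the basic argument are possible», the first of which is INTEGRALITY — «(i) No `[[13,0,6]]` code exists. Let `C` be a
`(13, 2¹³)` additive code with `d ≥ 5`, and let `C′` be its even subcode. … The condition that the weight distribution of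
`(C′)⊥` be integral implies certain congruence conditions on `A_5` and `A_6` …» [CalderbankEtAl1998, §7 (printed
pp. 27–28)]. This file types that strengthening of the system (16)–(21) ONCE, for all `(n,k,d)`:

* `CRSSIntFeasible n k d` — the unknowns are NATURAL NUMBERS `A_j` (weight distribution of the associated code `C`),
  `B_j` (of `C⊥`, CRSS's `A′_j`) and `W_j` (of `(C′)⊥`, `C′` the even subcode), with the MacWilliams identities
  written cleared of denominators (`2^{n−k} B_j = Σ_r P_j(r,n) A_r`, `2^{n−k} W_j = 2^e Σ_{r even} P_j(r,n) A_r`,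
  `2^e = [C : C′] ∈ {1, 2}`), `A_j = B_j` below `d`, `A_j ≤ B_j ≤ W_j` (`C′ ⊆ C ⊆ C⊥ ⊆ (C′)⊥`), `A_1 = 0`, and for
  `k = 0` the paper's purity convention `A_j = 0`, `1 ≤ j < d`;
* `IsAdditiveCode.crssIntFeasible` — every additive code without a weight-one stabilizer word solves it (the proof of
  Thm. 21, `QuaternaryMacWilliams.lean`, read in `ℕ`: the three unknowns ARE cardinalities);
* the bookkeeping by which Summits-side certificates become nonexistence theorems, exactly as for the real system in
  `LinearProgrammingBoundAdditive.lean`: `AdditiveCodeExists.exists_crssIntFeasible` (shortening away weight-one words,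
  Thm. 6 (e)), `not_additiveCodeExists_succ_int` (the column step), and the `k = 0` entry
  `not_additiveCodeExists_zero_of_not_crssIntFeasible` (no shortening needed: purity gives `A_1 = 0` once `d ≥ 2`);
Deliberately NOT here: any specific `(n,k,d)`; the refined (split) weight enumerator of §7 (ii); the branch-and-bound
certificates (`Summits/Ventures/QEC/Census/IPCertificate.lean`) — OUR side. HONEST FRAMING: a feasibility statement
necessary for existence; infeasibility certificates refute existence, nothing here certifies a distance.
Reference: [CalderbankEtAl1998] A. R. Calderbank, E. M. Rains, P. W. Shor, N. J. A. Sloane, *Quantum error correction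
via codes over GF(4)*, IEEE Trans. Inform. Theory 44 (1998) 1369–1387 = arXiv:quant-ph/9608006v5, §7 (Thm. 21 and the
examples (i)–(iii) after Thm. 22, printed pp. 26–28; held text chunk p0029).
-/

namespace Literature.InformationTheory.QuantumCodes

open Finset

/-! ### The integer system -/

/-- **CRSS's linear program (16)–(21) with integrality** («The condition that the weight distribution of `(C′)⊥` be
integral …»): there are natural numbers `A_0,…,A_n` (weight distribution of the `(n,2^{n−k})` additive code `C`),
`B_0,…,B_n` (of `C⊥`; CRSS's `A′_j`), `W_0,…,W_n` (of `(C′)⊥`, `C′` the even-weight subcode) and `e ∈ {0,1}`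
(`[C : C′] = 2^e`, eq. (20)) with `A_0 = 1`, `A_1 = 0` (16); `Σ_j A_j = 2^{n−k}` (17); `2^e Σ_{j even} A_j = 2^{n−k}`
(20); `2^{n−k} B_j = Σ_r P_j(r,n) A_r` (18) and `2^{n−k} W_j = 2^e Σ_{r even} P_j(r,n) A_r` (the MacWilliams
transform of `C′`, left side of (21)) for `j ≤ n`; `A_j = B_j` for `j < d` and `A_j ≤ B_j` (19); `B_j ≤ W_j` (21:
`C⊥ ⊆ (C′)⊥`); and, for `k = 0`, the paper's convention that an `[[n,0,d]]` is pure: `A_j = 0` for `1 ≤ j < d`.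
Column: definition (the paper's system (16)–(21) with its integrality side information made explicit).
[cite: CalderbankEtAl1998, §7 Thm. 21 eqs. (16)–(21) (printed p. 26) and example (i) after Thm. 22 (printed p. 28); §3 (printed p. 10, k = 0 convention)] -/
def CRSSIntFeasible (n k d : ℕ) : Prop :=
  ∃ (A B W : ℕ → ℕ) (e : ℕ), e ≤ 1 ∧
    A 0 = 1 ∧ A 1 = 0 ∧
    ∑ j ∈ range (n + 1), A j = 2 ^ (n - k) ∧
    2 ^ e * ∑ j ∈ (range (n + 1)).filter Even, A j = 2 ^ (n - k) ∧
    (∀ j, j ≤ n → (2 : ℤ) ^ (n - k) * B j = ∑ r ∈ range (n + 1), krawtchouk4 n j r * A r) ∧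
    (∀ j, j ≤ n →
      (2 : ℤ) ^ (n - k) * W j = 2 ^ e * ∑ r ∈ (range (n + 1)).filter Even, krawtchouk4 n j r * A r) ∧
    (∀ j, j < d → A j = B j) ∧
    (∀ j, j ≤ n → A j ≤ B j) ∧
    (∀ j, j ≤ n → B j ≤ W j) ∧
    (k = 0 → ∀ j, 1 ≤ j → j < d → A j = 0)

/-! ### Every additive code solves the integer system -/

section Proof

variable {n : ℕ}

open scoped Classical in
/-- `A_1 = 0` when the stabilizer space has no word of weight one. [cite: CalderbankEtAl1998, §7 before Thm. 21 («we may assume that A_1 = 0», printed p. 26)] -/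
theorem wtDist_one_eq_zero {S : Submodule (ZMod 2) (SympVec n)} (hw1 : ∀ v ∈ S, sympWeight v ≠ 1) :
    wtDist S 1 = 0 := by
  rw [wtDist, Finset.card_eq_zero, Finset.filter_eq_empty_iff]
  intro v hv; exact hw1 v (mem_codeWords.1 hv)

open scoped Classical in
/-- Purity below `d` for `k = 0`: an `[[n,0,d]]` (pure by the paper's convention) has `A_j = 0` for `1 ≤ j < d`.
[cite: CalderbankEtAl1998, §3 (printed p. 10: an [[n,0,d]] code is a self-dual code with minimal nonzero weight d)] -/
theorem wtDist_eq_zero_of_isAdditiveCode_zero {S : Submodule (ZMod 2) (SympVec n)} {d : ℕ}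
    (h : IsAdditiveCode S 0 d) {j : ℕ} (hj1 : 1 ≤ j) (hjd : j < d) : wtDist S j = 0 := by
  rw [wtDist, Finset.card_eq_zero, Finset.filter_eq_empty_iff]
  intro v hv hwt
  have hv0 : v ≠ 0 := fun h0 => by
    rw [h0, (sympWeight_eq_zero_iff _).2 rfl] at hwt; omega
  have := h.2.2.2 rfl v (mem_codeWords.1 hv) hv0
  omega

open scoped Classical in
/-- `Σ_{j ≤ n} A_j = |C|`. [cite: CalderbankEtAl1998, §7 Thm. 21 eq. (17) (printed p. 26)] -/
theorem sum_wtDist_eq_card (S : Submodule (ZMod 2) (SympVec n)) :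
    ∑ j ∈ range (n + 1), wtDist S j = #(codeWords S) := by
  have h := sum_codeWords_eq_sum_wtDist S (fun _ => (1 : ℕ))
  simp only [sum_const, smul_eq_mul, mul_one] at h
  exact h.symm

open scoped Classical in
/-- `Σ_{j ≤ n, j even} A_j = |C′|` (the even-weight subcode). [cite: CalderbankEtAl1998, §7 Thm. 21 eq. (20) and its proof (printed p. 26)] -/
theorem sum_wtDist_even_eq_card (S : Submodule (ZMod 2) (SympVec n)) (hS : IsSelfOrthogonal S) :
    ∑ j ∈ (range (n + 1)).filter Even, wtDist S j = #(codeWords (evenSub S hS)) := by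
  have h := sum_codeWords_filter_eq_sum_wtDist S Even (fun _ => (1 : ℕ))
  simp only [sum_const, smul_eq_mul, mul_one] at h
  rw [codeWords_evenSub]
  exact h.symm

open scoped Classical in
/-- The even part of the MacWilliams sum is the MacWilliams transform of `C′`:
`Σ_{r even} P_j(r,n) A_r = |C′| · #{w ∈ (C′)⊥ : wt w = j}`. [cite: CalderbankEtAl1998, §7 proof of Thm. 21 eq. (21) (printed p. 26)] -/
theorem sum_even_krawtchouk4_mul_wtDist (S : Submodule (ZMod 2) (SympVec n)) (hS : IsSelfOrthogonal S) (j : ℕ) :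
    ∑ r ∈ (range (n + 1)).filter Even, krawtchouk4 n j r * (wtDist S r : ℤ) =
      (#(codeWords (evenSub S hS)) : ℤ) * (wtDist (sympDual (evenSub S hS)) j : ℤ) := by
  rw [← sum_krawtchouk4_mul_wtDist (evenSub S hS) j]
  have h1 := sum_codeWords_filter_eq_sum_wtDist S Even (fun r => krawtchouk4 n j r)
  have h2 := sum_codeWords_eq_sum_wtDist (evenSub S hS) (fun r => krawtchouk4 n j r)
  simp only [nsmul_eq_mul] at h1 h2
  rw [Finset.sum_congr rfl fun r _ => mul_comm (krawtchouk4 n j r) _, ← h1,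
    Finset.sum_congr rfl fun r _ => mul_comm (krawtchouk4 n j r) _, ← h2, codeWords_evenSub]

open scoped Classical in
/-- **Every additive code solves CRSS's system WITH INTEGRALITY.** For an `[[n,k,d]]` additive code whose stabilizer
space `S̄` (the associated code `C`) has no word of weight `1`, the three weight distributions `A_j = #{C, wt j}`,
`B_j = #{C⊥, wt j}`, `W_j = #{(C′)⊥, wt j}` and `e = log₂ [C : C′]` satisfy `CRSSIntFeasible n k d`: (16)–(17) by
counting (`|C| = 2^{n−k}`); (18) and the `W`-identity by the MacWilliams identity (Thm. 5) for `C` and for `C′`;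
(19) from `C ⊆ C⊥` and the minimum-distance condition; (20) «`C′` is half or all of `C`» (eq. (7)); (21) from
`C⊥ ⊆ (C′)⊥`; the `k = 0` purity from the paper's convention. This is the integrality «side information» of §7 (i)
made a theorem: `A`, `B = A′` and the distribution of `(C′)⊥` are vectors of natural numbers. Column: PROVED.
[cite: CalderbankEtAl1998, §7 Thm. 21 with its proof (printed p. 26) and example (i) after Thm. 22 (printed p. 28)] -/
theorem IsAdditiveCode.crssIntFeasible {k d : ℕ} {S : Submodule (ZMod 2) (SympVec n)} (h : IsAdditiveCode S k d)
    (hw1 : ∀ v ∈ S, sympWeight v ≠ 1) : CRSSIntFeasible n k d := by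
  classical
  have hS : IsSelfOrthogonal S := h.1
  have hNk : Module.finrank (ZMod 2) S = n - k := by have := h.2.1; omega
  have hcard : #(codeWords S) = 2 ^ (n - k) := by rw [card_codeWords S, hNk]
  have hce := card_evenSub S hS
  -- `[C : C′] = 2^e`
  set e : ℕ := if #(codeWords (evenSub S hS)) = #(codeWords S) then 0 else 1 with he_def
  have he1 : e ≤ 1 := by rw [he_def]; split_ifs <;> omega
  have hidx : 2 ^ e * #(codeWords (evenSub S hS)) = #(codeWords S) := by
    rw [he_def]
    split_ifs with hall
    · rw [pow_zero, one_mul, hall]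
    · rcases hce with hall' | hhalf
      · exact absurd hall' hall
      · rw [pow_one]; exact hhalf
  have hidx' : 2 ^ e * #(codeWords (evenSub S hS)) = 2 ^ (n - k) := hidx.trans hcard
  refine ⟨fun j => wtDist S j, fun j => wtDist (sympDual S) j, fun j => wtDist (sympDual (evenSub S hS)) j, e,
    he1, wtDist_zero S, wtDist_one_eq_zero hw1, ?_, ?_, ?_, ?_, ?_, ?_, ?_, ?_⟩
  -- (17)
  · beta_reduce
    rw [sum_wtDist_eq_card, hcard]
  -- (20)
  · beta_reduce
    rw [sum_wtDist_even_eq_card S hS, hidx']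
  -- (18): `2^{n−k} B_j = Σ_r P_j(r,n) A_r`
  · intro j _
    beta_reduce
    rw [sum_krawtchouk4_mul_wtDist S j, hcard]; push_cast; ring
  -- the transform of `C′`: `2^{n−k} W_j = 2^e Σ_{r even} P_j(r,n) A_r`
  · intro j _
    beta_reduce
    rw [sum_even_krawtchouk4_mul_wtDist S hS j, ← mul_assoc]
    have h2 : (2 : ℤ) ^ e * (#(codeWords (evenSub S hS)) : ℤ) = (2 : ℤ) ^ (n - k) := by
      exact_mod_cast hidx'
    rw [h2]
  -- (19), `j < d`
  · intro j hjd
    exact wtDist_eq_wtDist_sympDual h hjd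
  -- (19), all `j`
  · intro j _
    exact wtDist_le_wtDist_sympDual hS j
  -- (21): `C⊥ ⊆ (C′)⊥`
  · intro j _
    exact wtDist_sympDual_mono (evenSub_le S hS) j
  -- `k = 0`: purity
  · intro hk j hj1 hjd
    subst hk
    exact wtDist_eq_zero_of_isAdditiveCode_zero h hj1 hjd

end Proof

/-! ### From integer infeasibility to nonexistence -/

section Consequences

/-- **The integer system for SOME length `m ≤ n`**: if an `[[n,k,d]]` additive code exists, then for some `m ≤ n` an
`[[m,k,d]]` additive code exists whose stabilizer space has no word of weight `1` (shorten, Thm. 6 (e)), and the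
integer system is feasible at `(m,k,d)`. Column: PROVED.
[cite: CalderbankEtAl1998, §7 Thm. 21 and the paragraph before it (printed p. 26), §4 Thm. 6 (e) (printed p. 13)] -/
theorem AdditiveCodeExists.exists_crssIntFeasible {n k d : ℕ} (h : AdditiveCodeExists n k d) :
    ∃ m, m ≤ n ∧ AdditiveCodeExists m k d ∧ CRSSIntFeasible m k d := by
  induction n with
  | zero =>
    obtain ⟨S, hS⟩ := h
    refine ⟨0, le_rfl, ⟨S, hS⟩, hS.crssIntFeasible fun v _ h1 => ?_⟩
    have := sympWeight_le v
    omega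
  | succ m ih =>
    rcases h.noWeightOne_or_shorten with ⟨S, hS, hw⟩ | h'
    · exact ⟨m + 1, le_rfl, ⟨S, hS⟩, hS.crssIntFeasible hw⟩
    · obtain ⟨m', hm', hc, hip⟩ := ih h'
      exact ⟨m', by omega, hc, hip⟩

/-- **The column step with integrality**: if no `[[m,k,d]]` exists and the INTEGER system is infeasible at
`(m+1, k, d′)` with `d ≤ d′`, then no `[[m+1,k,d′]]` exists (a weight-one stabilizer word would shorten the code to an
`[[m,k,d′]] ⊆ [[m,k,d]]`, Thm. 6 (e); otherwise the code solves the integer system). Column: PROVED.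
[cite: CalderbankEtAl1998, §7 Thm. 21 with §4 Thm. 6 (e) and the examples (i)–(iii) after Thm. 22 (printed pp. 13, 26, 28)] -/
theorem not_additiveCodeExists_succ_int {m k d d' : ℕ} (hprev : ¬ AdditiveCodeExists m k d)
    (hip : ¬ CRSSIntFeasible (m + 1) k d') (hdd : d ≤ d') : ¬ AdditiveCodeExists (m + 1) k d' := by
  intro h
  rcases h.noWeightOne_or_shorten with ⟨S, hS, hw⟩ | h'
  · exact hip (hS.crssIntFeasible hw)
  · obtain ⟨S, hS⟩ := h'
    exact hprev ⟨S, hS.mono hdd⟩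

/-- **The `k = 0` column with integrality, no shortening needed**: for `d ≥ 2` an `[[n,0,d]]` (pure by convention) has
no stabilizer word of weight `1`, so integer infeasibility at `(n,0,d)` refutes it directly. Column: PROVED.
[cite: CalderbankEtAl1998, §7 example (i) after Thm. 22 («No [[13,0,6]] code exists», printed p. 28) and §3 (printed p. 10)] -/
theorem not_additiveCodeExists_zero_of_not_crssIntFeasible {n d : ℕ} (hd : 2 ≤ d)
    (hip : ¬ CRSSIntFeasible n 0 d) : ¬ AdditiveCodeExists n 0 d := by
  rintro ⟨S, hS⟩
  refine hip (hS.crssIntFeasible fun v hv h1 => ?_)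
  have hv0 : v ≠ 0 := fun h0 => by rw [h0, (sympWeight_eq_zero_iff _).2 rfl] at h1; omega
  have := hS.2.2.2 rfl v hv hv0
  omega

end Consequences

end Literature.InformationTheory.QuantumCodes
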